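import Literature.Analysis.UnboundedOperators.HeatKernelBernsteinVector
import Literature.Analysis.FluidPDE.TaoEnstrophyLocalisationProofs
import HarnessLib

/-!
# Near-maximum flatness of the free heat flow of a bounded vector field

Analysis/UnboundedOperators file (all results proved, no definitions, no named facts). For a
finite-dimensional real inner product space `E`, the Gauss–Weierstrass kernel `G_t = heatKernel t`
(`0 < t`), a finite-dimensional real inner product space `F` and a continuous `u : E → F` with
`‖u‖ ≤ B` (e.g. a bounded velocity field `ℝ³ → ℝ³`), write `V = (e^{tΔ}u)(x) = heatExtension u t x`
and `L = ∇(e^{tΔ}u)(x) = fderiv ℝ (heatExtension u t) x` (a continuous linear map `E →L[ℝ] F`,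
measured in the operator norm). Then

* `two_mul_mul_sq_opNorm_fderiv_heatExtension_le`: `2t ‖L‖² ≤ B² − ‖V‖²`;
* `norm_fderiv_heatExtension_sq_le_near_sup`: `‖L‖² ≤ B (B − ‖V‖) / t` — **near-maximum
  flatness**: wherever the speed `‖V‖` of the free evolution is within `η` of the initial bound
  `B`, the full velocity gradient is at most `√(Bη/t)`
  (`norm_fderiv_heatExtension_sq_le_of_sub_le_norm`, `norm_fderiv_heatExtension_le_sqrt_near_sup`);
  product form `t ‖L‖² ≤ B (B − ‖V‖)` and directional form `‖L v‖² ≤ B (B − ‖V‖) / t · ‖v‖²`.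

These are the operator-norm forms of the caloric Bernstein estimate
`two_mul_mul_sum_sq_norm_fderiv_heatExtension_le` of `HeatKernelBernsteinVector.lean` (Frobenius
form `2t ∑ᵢ ‖L bᵢ‖² ≤ B² − ‖V‖²`, from the reverse local Poincaré inequality of the heat
semigroup, Bakry–Gentil–Ledoux 2014, Thm. 4.7.2), combined with `‖L‖² ≤ ∑ᵢ ‖L bᵢ‖²` (operator
norm at most Frobenius norm: the tree's `Literature.Analysis.FluidPDE.sq_opNorm_le_sum_sq_norm_apply`,
whence the import of `FluidPDE.TaoEnstrophyLocalisationProofs`) and the factorisation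
`B² − ‖V‖² = (B − ‖V‖)(B + ‖V‖) ≤ 2B (B − ‖V‖)`, valid because `‖V‖ ≤ B` (maximum principle,
`norm_heatExtension_le`). The constant in `‖L‖² ≤ B (B − ‖V‖)/t` is `1`; the cruder route through
`∇(e^{tΔ}u)(x) = ∫ ∇G_t(y) ⊗ (u(x − y) − B e) dy`, Cauchy–Schwarz in `L²(G_t)` and the second
moments `∫ ⟪y, h⟫² G_t = 2t‖h‖²` gives the same bound. Used for level sets of the speed near its
maximum (early-window bookkeeping) in `Summits/NavierStokesRegularity`, route `LevelSetModeration`.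

Not here: the logarithmic refinement near the zero level (Hamilton's estimate), time derivatives,
anything specific to the Navier–Stokes evolution.

## References

* D. Bakry, I. Gentil, M. Ledoux, *Analysis and Geometry of Markov Diffusion Operators*,
  Springer 2014, Thm. 4.7.2 (reverse local Poincaré inequality of the heat semigroup).
* L. C. Evans, *Partial Differential Equations*, 2nd ed. (2010), §2.3.1 (heat kernel, maximum
  principle).
-/

open MeasureTheory Filter Topology Set InnerProductSpace Metric
open scoped Real RealInnerProductSpace

noncomputable section

namespace Literature.Analysis.UnboundedOperators

variable {E : Type*} [NormedAddCommGroup E] [InnerProductSpace ℝ E] [FiniteDimensional ℝ E]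
  [MeasurableSpace E] [BorelSpace E]
variable {F : Type*} [NormedAddCommGroup F] [InnerProductSpace ℝ F] [FiniteDimensional ℝ F]

/-! ### Near-maximum flatness of the caloric extension of a bounded vector field -/

/-- **Caloric Bernstein estimate for vector fields, operator-norm form.** For a continuous
`u : E → F` between finite-dimensional real inner product spaces with `‖u‖ ≤ B`, `0 < t` and
`x ∈ E`: `2t ‖∇(e^{tΔ}u)(x)‖² ≤ B² − ‖(e^{tΔ}u)(x)‖²` (operator norm of the Fréchet derivative;
the Frobenius form `two_mul_mul_sum_sq_norm_fderiv_heatExtension_le`, i.e. the reverse local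
Poincaré inequality of the heat semigroup, Bakry–Gentil–Ledoux 2014, Thm. 4.7.2, summed over the
components, and `‖L‖² ≤ ∑ᵢ ‖L bᵢ‖²`). [folklore] -/
theorem two_mul_mul_sq_opNorm_fderiv_heatExtension_le {u : E → F} (hu : Continuous u) {B : ℝ}
    (hB : ∀ z, ‖u z‖ ≤ B) {t : ℝ} (ht : 0 < t) (x : E) :
    2 * t * ‖fderiv ℝ (heatExtension u t) x‖ ^ 2 ≤ B ^ 2 - ‖heatExtension u t x‖ ^ 2 := by
  haveI : CompleteSpace F := FiniteDimensional.complete ℝ F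
  have h := two_mul_mul_sum_sq_norm_fderiv_heatExtension_le hu hB ht x (stdOrthonormalBasis ℝ E)
  have hop := Literature.Analysis.FluidPDE.sq_opNorm_le_sum_sq_norm_apply
    (stdOrthonormalBasis ℝ E) (fderiv ℝ (heatExtension u t) x)
  have h2t : (0 : ℝ) ≤ 2 * t := by positivity
  exact (mul_le_mul_of_nonneg_left hop h2t).trans h

/-- **Near-maximum flatness of the free heat flow.** For a continuous `u : E → F` between
finite-dimensional real inner product spaces with `‖u‖ ≤ B` (e.g. a bounded velocity field
`ℝ³ → ℝ³`), `0 < t` and `x ∈ E`: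
`‖∇(e^{tΔ}u)(x)‖² ≤ B (B − ‖(e^{tΔ}u)(x)‖) / t` — the full gradient of the free evolution of a
bounded field is small wherever its pointwise norm is close to the initial bound (gradient
estimate for bounded caloric functions near their supremum; cf. the Li–Yau / Bernstein estimates).
From `two_mul_mul_sq_opNorm_fderiv_heatExtension_le` and
`B² − ‖V‖² = (B − ‖V‖)(B + ‖V‖) ≤ 2B (B − ‖V‖)`, as `‖V‖ ≤ B` by the maximum principle. [folklore] -/
theorem norm_fderiv_heatExtension_sq_le_near_sup {u : E → F} (hu : Continuous u) {B : ℝ}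
    (hB : ∀ z, ‖u z‖ ≤ B) {t : ℝ} (ht : 0 < t) (x : E) :
    ‖fderiv ℝ (heatExtension u t) x‖ ^ 2 ≤ B * (B - ‖heatExtension u t x‖) / t := by
  have h := two_mul_mul_sq_opNorm_fderiv_heatExtension_le hu hB ht x
  have hV : ‖heatExtension u t x‖ ≤ B := norm_heatExtension_le hB ht x
  rw [le_div_iff₀ ht]
  nlinarith [sq_nonneg (B - ‖heatExtension u t x‖), norm_nonneg (heatExtension u t x)]

/-- Near-maximum flatness, product form: `t ‖∇(e^{tΔ}u)(x)‖² ≤ B (B − ‖(e^{tΔ}u)(x)‖)` for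
continuous `u` with `‖u‖ ≤ B` and `0 < t`. [folklore] -/
theorem mul_norm_fderiv_heatExtension_sq_le_near_sup {u : E → F} (hu : Continuous u) {B : ℝ}
    (hB : ∀ z, ‖u z‖ ≤ B) {t : ℝ} (ht : 0 < t) (x : E) :
    t * ‖fderiv ℝ (heatExtension u t) x‖ ^ 2 ≤ B * (B - ‖heatExtension u t x‖) := by
  have h := norm_fderiv_heatExtension_sq_le_near_sup hu hB ht x
  rwa [le_div_iff₀ ht, mul_comm] at h

/-- Near-maximum flatness, unsquared form:
`‖∇(e^{tΔ}u)(x)‖ ≤ √(B (B − ‖(e^{tΔ}u)(x)‖) / t)` for continuous `u` with `‖u‖ ≤ B` and `0 < t`.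
[folklore] -/
theorem norm_fderiv_heatExtension_le_sqrt_near_sup {u : E → F} (hu : Continuous u) {B : ℝ}
    (hB : ∀ z, ‖u z‖ ≤ B) {t : ℝ} (ht : 0 < t) (x : E) :
    ‖fderiv ℝ (heatExtension u t) x‖ ≤ Real.sqrt (B * (B - ‖heatExtension u t x‖) / t) :=
  Real.le_sqrt_of_sq_le (norm_fderiv_heatExtension_sq_le_near_sup hu hB ht x)

/-- Near-maximum flatness on a super-level set of the speed: if `‖u‖ ≤ B`, `0 < t` and
`B − η ≤ ‖(e^{tΔ}u)(x)‖`, then `‖∇(e^{tΔ}u)(x)‖² ≤ B η / t` (on the set where the free evolution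
of a bounded velocity field has speed at least `B − η`, its gradient is at most `√(Bη/t)`).
[folklore] -/
theorem norm_fderiv_heatExtension_sq_le_of_sub_le_norm {u : E → F} (hu : Continuous u) {B : ℝ}
    (hB : ∀ z, ‖u z‖ ≤ B) {t : ℝ} (ht : 0 < t) {x : E} {η : ℝ}
    (hη : B - η ≤ ‖heatExtension u t x‖) :
    ‖fderiv ℝ (heatExtension u t) x‖ ^ 2 ≤ B * η / t := by
  have h := norm_fderiv_heatExtension_sq_le_near_sup hu hB ht x
  have hB0 : 0 ≤ B := (norm_nonneg _).trans (hB x)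
  refine h.trans (div_le_div_of_nonneg_right ?_ ht.le)
  exact mul_le_mul_of_nonneg_left (by linarith) hB0

/-- Near-maximum flatness, directional form:
`‖∂ᵥ(e^{tΔ}u)(x)‖² ≤ B (B − ‖(e^{tΔ}u)(x)‖) / t · ‖v‖²` for continuous `u` with `‖u‖ ≤ B`,
`0 < t` and every direction `v`. [folklore] -/
theorem norm_fderiv_heatExtension_apply_sq_le_near_sup {u : E → F} (hu : Continuous u) {B : ℝ}
    (hB : ∀ z, ‖u z‖ ≤ B) {t : ℝ} (ht : 0 < t) (x v : E) :
    ‖fderiv ℝ (heatExtension u t) x v‖ ^ 2 ≤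
      B * (B - ‖heatExtension u t x‖) / t * ‖v‖ ^ 2 := by
  have h := norm_fderiv_heatExtension_sq_le_near_sup hu hB ht x
  calc ‖fderiv ℝ (heatExtension u t) x v‖ ^ 2
      ≤ (‖fderiv ℝ (heatExtension u t) x‖ * ‖v‖) ^ 2 :=
        pow_le_pow_left₀ (norm_nonneg _) (ContinuousLinearMap.le_opNorm _ _) 2
    _ = ‖fderiv ℝ (heatExtension u t) x‖ ^ 2 * ‖v‖ ^ 2 := mul_pow _ _ _
    _ ≤ B * (B - ‖heatExtension u t x‖) / t * ‖v‖ ^ 2 :=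
        mul_le_mul_of_nonneg_right h (sq_nonneg _)

end Literature.Analysis.UnboundedOperators

end
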